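import Mathlib.FieldTheory.KrullTopology
import Mathlib.FieldTheory.Galois.Infinite
import Mathlib.FieldTheory.PrimitiveElement
import Mathlib.NumberTheory.NumberField.Basic
import Mathlib.Data.Nat.Squarefree
import Mathlib.Data.Nat.PrimeFin
import Mathlib.Data.Rat.Lemmas
import Mathlib.Algebra.Polynomial.Degree.SmallDegree
import Literature.AnabelianGeometry.AbsoluteAnabelian.AbsTopISemiAbsolute
import Literature.AnabelianGeometry.AbsoluteAnabelian.GaloisSubextensionProofs
import HarnessLib

/-!
# [AbsTopI] Thm 2.6 (vi) "`Π` is not topologically finitely generated" — UNCONDITIONAL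

S. Mochizuki, *Topics in Absolute Anabelian Geometry I: Generalities* (2012) [AbsTopI], Thm 2.6
(vi) p. 22 (manuscript pagination, lit key paper:url-11ac98ba15fc): for `k` an NF, "In particular,
`Π` is not topologically finitely generated."  The statement file `AbsTopISemiAbsolute.lean`
(abc-iut-L4-t4) records this sentence, for ALL abstract extensions `1 → Δ → Π → G → 1` with
`G ≅ G_F`, `F` a number field, as the closed named fact `FundamentalExtension.thm26_vi_not_tfg`
(print: "`G_F` is a quotient of `Π` and is itself not topologically finitely generated (it is very
elastic, [AbsTopI] Thm 1.7 (iii) p. 14)").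

This PROOF-ONLY companion discharges it with NO named input, by kernel-checking the classical
fact that **the absolute Galois group of a number field is not topologically finitely
generated**:

* §1 `finite_setOf_isOpen_index_two`: a topologically finitely generated topological group has
  only finitely many OPEN subgroups of index `2` — such a subgroup is determined by which members
  of a topologically generating finite set it contains (`Subgroup.mul_mem_iff_of_index_two`:
  the locus where membership in two index-`2` subgroups agrees is a subgroup; it is clopen, hence
  everything once it contains a dense subgroup).
* §2 `isSquare_or_isSquare_mul_of_mem_adjoin_simple`: if `α² = a`, `β² = b` with `b` a
  non-square of `F` and `α ∈ F(β)`, then `a` or `a·b` is a square in `F` (write `α = x + yβ`).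
* §3–§4 `finite_setOf_squarefree_isSquare`: a number field contains square roots of only
  finitely many squarefree integers `d ≠ 1` (they generate pairwise distinct subfields `ℚ(√d)`,
  and `F/ℚ` has finitely many intermediate fields by the primitive element theorem); hence for
  all primes `p ≠ q` beyond a bound, `p` and `p·q` are non-squares in `F`.
* §5 `infinite_setOf_isOpen_index_two_gal`: the subgroups `Gal(F̄/F(√p))`, `p` prime beyond the
  bound, are pairwise distinct open subgroups of index `2` of `Gal(F̄/F)` (infinite Galois
  correspondence `InfiniteGalois.fixedField_fixingSubgroup`,
  `IntermediateField.finrank_eq_fixingSubgroup_index`), so `Gal(F̄/F)` is not topologically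
  finitely generated (`not_isTopologicallyFinitelyGenerated_absoluteGaloisGroup`).
* §6 `FundamentalExtension.thm26_vi_not_tfg_holds`: `Π ↠ G ≅ G_F` and topological finite
  generation descends to quotients (`GaloisSubextensionProofs.lean`, abc-iut-L4-t11).

Relation to abc-iut-L4-t11's `AbsTopISemiAbsoluteProofs.lean`: that file kernel-checks the
PRINTED deduction of both Thm 2.6 (vi) sentences from [AbsAnab] Thm 1.1.2 (a named fact,
[FJ] 15.10); the present file removes that dependence for the "not tfg" sentence.  Distinct module
and declaration names; nothing of the statement files is restated; no definition is introduced.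
HONEST FRAMING: a classical fact about number fields; no bearing on [IUTchIII] Cor. 3.12.
-/

noncomputable section

open Polynomial

namespace Literature.AnabelianGeometry.AbsoluteAnabelian

open Field

universe u

/-! ### §1. Open subgroups of index 2 in a topologically finitely generated group -/

section IndexTwo

variable {G : Type u} [Group G] [TopologicalSpace G] [IsTopologicalGroup G]

/-- Two OPEN subgroups of index `2` of a topological group which contain the same elements of a
set `s` generating a dense subgroup are equal: the locus `{g | g ∈ H ↔ g ∈ H'}` is a subgroup
(`Subgroup.mul_mem_iff_of_index_two`), closed (both subgroups are clopen), and contains `s`.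
Group-theoretic step of our proof of the "not topologically finitely generated" clause of
[AbsTopI] Thm 1.7 (iii). [cite: MochizukiAbsTopI2012, Thm 1.7 (iii) p.14] -/
theorem eq_of_isOpen_of_index_two {s : Set G}
    (hs : (Subgroup.closure s).topologicalClosure = ⊤) {H H' : Subgroup G}
    (hH : IsOpen (H : Set G)) (h2 : H.index = 2) (hH' : IsOpen (H' : Set G))
    (h2' : H'.index = 2) (hagree : ∀ x ∈ s, x ∈ H ↔ x ∈ H') : H = H' := by
  set S : Set G := {g | g ∈ H ↔ g ∈ H'} with hS_def
  let A : Subgroup G :=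
    { carrier := S
      one_mem' := by
        change (1 : G) ∈ H ↔ (1 : G) ∈ H'
        exact iff_of_true H.one_mem H'.one_mem
      mul_mem' := fun {a b} ha hb => by
        change a ∈ H ↔ a ∈ H' at ha
        change b ∈ H ↔ b ∈ H' at hb
        change a * b ∈ H ↔ a * b ∈ H'
        rw [Subgroup.mul_mem_iff_of_index_two h2, Subgroup.mul_mem_iff_of_index_two h2']
        tauto
      inv_mem' := fun {a} ha => by
        change a ∈ H ↔ a ∈ H' at ha
        change a⁻¹ ∈ H ↔ a⁻¹ ∈ H'
        rw [inv_mem_iff, inv_mem_iff]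
        exact ha }
  have hA_closed : IsClosed (A : Set G) := by
    have hHc : IsClosed (H : Set G) := H.isClosed_of_isOpen hH
    have hH'c : IsClosed (H' : Set G) := H'.isClosed_of_isOpen hH'
    have hAS : (A : Set G) = ((H : Set G) ∩ (H' : Set G)) ∪ ((H : Set G)ᶜ ∩ (H' : Set G)ᶜ) := by
      ext g
      change (g ∈ H ↔ g ∈ H') ↔ _
      simp only [Set.mem_union, Set.mem_inter_iff, Set.mem_compl_iff, SetLike.mem_coe]
      tauto
    rw [hAS]
    exact (hHc.inter hH'c).union (hH.isClosed_compl.inter hH'.isClosed_compl)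
  have hle : (Subgroup.closure s).topologicalClosure ≤ A :=
    Subgroup.topologicalClosure_minimal _
      ((Subgroup.closure_le A).2 fun x hx => hagree x hx) hA_closed
  rw [hs, top_le_iff] at hle
  ext g
  have hg : g ∈ A := by rw [hle]; exact Subgroup.mem_top g
  exact hg

/-- A topologically finitely generated topological group has only finitely many OPEN subgroups
of index `2`: by `eq_of_isOpen_of_index_two` such a subgroup is determined by the subset of a
(finite) topologically generating set that it contains.  Group-theoretic step of our proof of the
"not topologically finitely generated" clause of [AbsTopI] Thm 1.7 (iii).
[cite: MochizukiAbsTopI2012, Thm 1.7 (iii) p.14] -/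
theorem IsTopologicallyFinitelyGenerated.finite_setOf_isOpen_index_two
    (h : IsTopologicallyFinitelyGenerated G) :
    {H : Subgroup G | IsOpen (H : Set G) ∧ H.index = 2}.Finite := by
  classical
  obtain ⟨s, hs⟩ := h.exists_finset
  let f : Subgroup G → Finset G := fun H => s.filter (fun x => x ∈ H)
  refine Set.Finite.of_finite_image (f := f) ?_ ?_
  · refine (s.powerset.finite_toSet).subset ?_
    rintro _ ⟨H, -, rfl⟩
    rw [Finset.mem_coe, Finset.mem_powerset]
    exact Finset.filter_subset _ _
  · intro H hH H' hH' hf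
    refine eq_of_isOpen_of_index_two hs hH.1 hH.2 hH'.1 hH'.2 fun x hx => ?_
    have hx' : x ∈ s := Finset.mem_coe.mp hx
    have key : x ∈ f H ↔ x ∈ f H' := by rw [hf]
    simpa [f, Finset.mem_filter, hx'] using key

end IndexTwo

/-! ### §2. Quadratic subextensions: `α ∈ F(β)`, `β² = b ∉ F²`, `α² = a` ⇒ `a ∈ F²` or `ab ∈ F²` -/

section Quadratic

variable {F K : Type*} [Field F] [Field K] [Algebra F K]

/-- If `β² = b ∈ F`, every element of `F(β)` is of the form `x + y·β` with `x, y ∈ F`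
(division with remainder by `X² − b`).  Field-theoretic step of our proof of the "not
topologically finitely generated" clause of [AbsTopI] Thm 1.7 (iii). [cite: MochizukiAbsTopI2012, Thm 1.7 (iii) p.14] -/
theorem exists_eq_add_mul_of_mem_adjoin_simple {β : K} {b : F}
    (hβ : β ^ 2 = algebraMap F K b) {α : K} (hα : α ∈ IntermediateField.adjoin F {β}) :
    ∃ x y : F, α = algebraMap F K x + algebraMap F K y * β := by
  set q : F[X] := X ^ 2 - C b with hq_def
  have hq : q.Monic := monic_X_pow_sub_C b two_ne_zero
  have hroot : aeval β q = 0 := by simp [hq_def, hβ]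
  have hint : IsIntegral F β := by
    refine ⟨q, hq, ?_⟩
    rwa [aeval_def] at hroot
  rw [← IntermediateField.mem_toSubalgebra,
    IntermediateField.adjoin_simple_toSubalgebra_of_isAlgebraic hint.isAlgebraic,
    Algebra.adjoin_singleton_eq_range_aeval, AlgHom.mem_range] at hα
  obtain ⟨f, rfl⟩ := hα
  refine ⟨(f %ₘ q).coeff 0, (f %ₘ q).coeff 1, ?_⟩
  have hq1 : q ≠ 1 := by
    intro h1
    have h := congrArg natDegree h1
    rw [hq_def, natDegree_X_pow_sub_C, natDegree_one] at h
    exact two_ne_zero h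
  have hqdeg : q.natDegree = 2 := by rw [hq_def, natDegree_X_pow_sub_C]
  have hnat : (f %ₘ q).natDegree ≤ 1 := by
    have h := natDegree_modByMonic_lt f hq hq1
    rw [hqdeg] at h
    omega
  have hdeg : (f %ₘ q).degree ≤ 1 := degree_le_of_natDegree_le hnat
  rw [← aeval_modByMonic_eq_self_of_root hroot (p := f)]
  conv_lhs => rw [eq_X_add_C_of_degree_le_one hdeg]
  simp only [map_add, map_mul, aeval_C, aeval_X]
  ring

/-- The Kummer-theoretic dichotomy behind "distinct square classes give distinct quadratic
extensions": if `α² = a`, `β² = b` (`a, b ∈ F`, `char F ≠ 2`), `b` is not a square in `F` and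
`α ∈ F(β)`, then `a` is a square in `F` or `a·b` is a square in `F` (write `α = x + yβ`; then
`2xy·β ∈ F` forces `xy = 0`).  Field-theoretic step of our proof of the "not topologically
finitely generated" clause of [AbsTopI] Thm 1.7 (iii). [cite: MochizukiAbsTopI2012, Thm 1.7 (iii) p.14] -/
theorem isSquare_or_isSquare_mul_of_mem_adjoin_simple (h2 : (2 : F) ≠ 0) {a b : F} {α β : K}
    (hαa : α ^ 2 = algebraMap F K a) (hβb : β ^ 2 = algebraMap F K b) (hb : ¬ IsSquare b)
    (hmem : α ∈ IntermediateField.adjoin F {β}) : IsSquare a ∨ IsSquare (a * b) := by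
  obtain ⟨x, y, hxy⟩ := exists_eq_add_mul_of_mem_adjoin_simple hβb hmem
  set ι := algebraMap F K with hι
  have hιinj : Function.Injective ι := ι.injective
  have hsq : ι a = ι (x ^ 2 + y ^ 2 * b) + ι (2 * x * y) * β := by
    rw [← hαa, hxy]
    have h : (ι x + ι y * β) ^ 2 = ι x ^ 2 + ι y ^ 2 * β ^ 2 + 2 * ι x * ι y * β := by ring
    rw [h, hβb]
    simp only [map_add, map_mul, map_pow, map_ofNat]
  by_cases hxy0 : 2 * x * y = 0
  · have hx_or : x = 0 ∨ y = 0 := by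
      rcases mul_eq_zero.mp hxy0 with h | h
      · rcases mul_eq_zero.mp h with h' | h'
        · exact absurd h' h2
        · exact Or.inl h'
      · exact Or.inr h
    rcases hx_or with hx | hy
    · -- `α = yβ`, so `a = y²b` and `ab = (yb)²`
      right
      refine ⟨y * b, hιinj ?_⟩
      have ha : ι a = ι (y ^ 2 * b) := by
        rw [hsq, hx]
        simp
      rw [map_mul, ha, ← map_mul]
      congr 1
      ring
    · -- `α = x`, so `a = x²`
      left
      refine ⟨x, hιinj ?_⟩
      rw [hsq, hy]
      simp [pow_two]
  · -- `β ∈ F`: contradiction with `b ∉ F²`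
    exfalso
    apply hb
    have hne : ι (2 * x * y) ≠ 0 := (map_ne_zero ι).mpr hxy0
    have key : ι (2 * x * y) * β = ι (a - x ^ 2 - y ^ 2 * b) := by
      rw [map_sub, map_sub, hsq]
      simp only [map_add, map_mul, map_pow]
      ring
    have hβ : β = ι ((a - x ^ 2 - y ^ 2 * b) / (2 * x * y)) := by
      rw [map_div₀, ← key, mul_div_cancel_left₀ β hne]
    refine ⟨(a - x ^ 2 - y ^ 2 * b) / (2 * x * y), hιinj ?_⟩
    rw [map_mul, ← hβ, ← hβb, sq]

end Quadratic

/-! ### §3. Squarefree integers and squares -/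

section NatSquares

/-- A squarefree natural number `≠ 1` is not a square. [folklore] -/
private theorem not_isSquare_of_squarefree_of_ne_one {d : ℕ} (hd : Squarefree d) (h1 : d ≠ 1) :
    ¬ IsSquare d := by
  rintro ⟨m, rfl⟩
  have hm : IsUnit m := hd m (dvd_refl _)
  rw [Nat.isUnit_iff] at hm
  subst hm
  exact h1 (by norm_num)

/-- The product of two DISTINCT squarefree natural numbers is not a square: a square `d·d'` has
the same prime divisors in `d` and in `d'`, so `d = d'` by `Nat.Squarefree.ext_iff`.
[folklore] -/
private theorem not_isSquare_mul_of_squarefree_of_ne {d d' : ℕ} (hd : Squarefree d)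
    (hd' : Squarefree d') (hne : d ≠ d') : ¬ IsSquare (d * d') := by
  rintro ⟨m, hm⟩
  apply hne
  -- one direction of the symmetric key statement
  have key : ∀ {e e' : ℕ}, Squarefree e → e * e' = m * m →
      ∀ p : ℕ, Prime p → p ∣ e → p ∣ e' := by
    intro e e' he hee' p hp hpe
    obtain ⟨c, rfl⟩ := hpe
    have hpc : ¬ p ∣ c := fun hc => hp.not_unit (he p (mul_dvd_mul_left p hc))
    have hpm : p ∣ m := by
      have h : p ∣ m * m := ⟨c * e', by rw [← hee']; ring⟩
      exact (hp.dvd_mul.mp h).elim id id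
    obtain ⟨k, rfl⟩ := hpm
    have h2 : c * e' = p * (k * k) := by
      apply mul_left_cancel₀ hp.ne_zero
      rw [show p * (c * e') = p * c * e' by ring, hee']
      ring
    have h3 : p ∣ c * e' := ⟨k * k, h2⟩
    exact (hp.dvd_mul.mp h3).resolve_left hpc
  rw [Nat.Squarefree.ext_iff hd hd']
  intro p hp
  exact ⟨key hd hm p hp.prime, key hd' (by rw [mul_comm]; exact hm) p hp.prime⟩

end NatSquares

/-! ### §4. A number field contains `√d` for only finitely many squarefree `d` -/

section NumberFieldSquares

variable (F : Type*) [Field F] [NumberField F]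

/-- A number field `F` contains square roots of only finitely many squarefree integers `d ≠ 1`:
the subfields `ℚ(√d) ⊆ F` are pairwise distinct (§2–§3), and `F/ℚ` has only finitely many
intermediate fields (primitive element theorem,
`Field.finite_intermediateField_of_exists_primitive_element`).  Arithmetic step of our proof of
the "not topologically finitely generated" clause of [AbsTopI] Thm 1.7 (iii).
[cite: MochizukiAbsTopI2012, Thm 1.7 (iii) p.14] -/
theorem finite_setOf_squarefree_isSquare :
    {d : ℕ | Squarefree d ∧ d ≠ 1 ∧ IsSquare (d : F)}.Finite := by
  classical
  haveI : Finite (IntermediateField ℚ F) :=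
    Field.finite_intermediateField_of_exists_primitive_element ℚ F
      (Field.exists_primitive_element ℚ F)
  set T : Set ℕ := {d : ℕ | Squarefree d ∧ d ≠ 1 ∧ IsSquare (d : F)} with hT
  have hroot : ∀ d ∈ T, ∃ r : F, r ^ 2 = (d : F) := fun d hd => by
    obtain ⟨r, hr⟩ := hd.2.2
    exact ⟨r, by rw [sq, hr]⟩
  choose! r hr using hroot
  let g : ℕ → IntermediateField ℚ F := fun d => IntermediateField.adjoin ℚ {r d}
  refine Set.Finite.of_finite_image (f := g) (Set.toFinite _) fun d hd d' hd' hg => ?_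
  by_contra hne
  have hmem : r d ∈ IntermediateField.adjoin ℚ {r d'} := by
    have h : r d ∈ g d := IntermediateField.mem_adjoin_simple_self ℚ (r d)
    rw [hg] at h
    exact h
  have hb : ¬ IsSquare (d' : ℚ) := by
    rw [Rat.isSquare_natCast_iff]
    exact not_isSquare_of_squarefree_of_ne_one hd'.1 hd'.2.1
  have h := isSquare_or_isSquare_mul_of_mem_adjoin_simple (F := ℚ) (K := F) two_ne_zero
    (a := (d : ℚ)) (b := (d' : ℚ)) (α := r d) (β := r d')
    (by rw [map_natCast]; exact hr d hd) (by rw [map_natCast]; exact hr d' hd') hb hmem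
  rcases h with h | h
  · rw [Rat.isSquare_natCast_iff] at h
    exact not_isSquare_of_squarefree_of_ne_one hd.1 hd.2.1 h
  · rw [← Nat.cast_mul, Rat.isSquare_natCast_iff] at h
    exact not_isSquare_mul_of_squarefree_of_ne hd.1 hd'.1 hne h

/-- Beyond a bound depending on the number field `F`, rational primes `p` and products `p·q` of
two distinct rational primes are NOT squares in `F`.  Arithmetic step of our proof of the "not
topologically finitely generated" clause of [AbsTopI] Thm 1.7 (iii). [cite: MochizukiAbsTopI2012, Thm 1.7 (iii) p.14] -/
theorem exists_bound_prime_not_isSquare :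
    ∃ B : ℕ, (∀ p : ℕ, p.Prime → B < p → ¬ IsSquare (p : F)) ∧
      (∀ p q : ℕ, p.Prime → q.Prime → B < p → B < q → p ≠ q → ¬ IsSquare ((p : F) * q)) := by
  obtain ⟨B, hB⟩ := (finite_setOf_squarefree_isSquare F).bddAbove
  refine ⟨B, fun p hp hBp hsq => ?_, fun p q hp hq hBp hBq hpq hsq => ?_⟩
  · have hmem : p ∈ {d : ℕ | Squarefree d ∧ d ≠ 1 ∧ IsSquare (d : F)} :=
      ⟨hp.prime.squarefree, hp.ne_one, hsq⟩
    exact absurd (hB hmem) (not_le.mpr hBp)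
  · have hsf : Squarefree (p * q) :=
      (Nat.squarefree_mul ((Nat.coprime_primes hp hq).mpr hpq)).mpr
        ⟨hp.prime.squarefree, hq.prime.squarefree⟩
    have hlt : B < p * q := lt_of_lt_of_le hBp (Nat.le_mul_of_pos_right p hq.pos)
    have hne1 : p * q ≠ 1 := by
      intro h
      exact hp.ne_one (Nat.eq_one_of_mul_eq_one_right h)
    have hmem : p * q ∈ {d : ℕ | Squarefree d ∧ d ≠ 1 ∧ IsSquare (d : F)} :=
      ⟨hsf, hne1, by rw [Nat.cast_mul]; exact hsq⟩
    exact absurd (hB hmem) (not_le.mpr hlt)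

end NumberFieldSquares

/-! ### §5. `Gal(F̄/F)` is not topologically finitely generated -/

section Galois

variable (F : Type u) [Field F] [NumberField F]

/-- For a number field `F`, the profinite group `Gal(F̄/F)` has infinitely many open subgroups of
index `2`: the subgroups `Gal(F̄/F(√p))` for the rational primes `p` beyond the bound of
`exists_bound_prime_not_isSquare` are pairwise distinct (`F(√p) = F(√q)` would make `p` or
`p·q` a square in `F`, §2), open, and of index `[F(√p) : F] = 2`.  This is the substance of the
"not topologically finitely generated" clause of [AbsTopI] Thm 1.7 (iii) ("if `k` is an NF, then
`G_k` is very elastic"; Def 1.1 (ii): very elastic = elastic and not topologically finitely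
generated), for `k̃ = k̄`; print derives (iii) from [Mzk11] Cor 2.2 / Thm 2.4, our proof is the
elementary quadratic-extension count. [cite: MochizukiAbsTopI2012, Thm 1.7 (iii) p.14] -/
theorem infinite_setOf_isOpen_index_two_gal :
    {H : Subgroup (AlgebraicClosure F ≃ₐ[F] AlgebraicClosure F) |
      IsOpen (H : Set (AlgebraicClosure F ≃ₐ[F] AlgebraicClosure F)) ∧ H.index = 2}.Infinite := by
  classical
  obtain ⟨B, hB1, hB2⟩ := exists_bound_prime_not_isSquare F
  -- square roots of the rational primes in `F̄`
  have hroot : ∀ p : ℕ, ∃ a : AlgebraicClosure F, a ^ 2 = (p : AlgebraicClosure F) :=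
    fun p => IsAlgClosed.exists_pow_nat_eq _ two_pos
  choose α hα using hroot
  have hα' : ∀ p : ℕ, α p ^ 2 = algebraMap F (AlgebraicClosure F) (p : F) := fun p => by
    rw [map_natCast]; exact hα p
  let E : ℕ → IntermediateField F (AlgebraicClosure F) := fun p => IntermediateField.adjoin F {α p}
  let Hp : ℕ → Subgroup (AlgebraicClosure F ≃ₐ[F] AlgebraicClosure F) :=
    fun p => (E p).fixingSubgroup
  have hint : ∀ p, IsIntegral F (α p) := fun p => Algebra.IsIntegral.isIntegral (α p)
  have hfd : ∀ p, FiniteDimensional F (E p) := fun p =>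
    IntermediateField.adjoin.finiteDimensional (hint p)
  -- `[F(√p) : F] = 2` once `p` is not a square in `F`
  have hdeg : ∀ p : ℕ, p.Prime → B < p → Module.finrank F (E p) = 2 := by
    intro p hp hBp
    have hdvd : minpoly F (α p) ∣ X ^ 2 - C (p : F) :=
      minpoly.dvd F (α p) (by simp [hα p])
    have hle : (minpoly F (α p)).natDegree ≤ 2 := by
      have h := natDegree_le_of_dvd hdvd (X_pow_sub_C_ne_zero two_pos _)
      rwa [natDegree_X_pow_sub_C] at h
    have hpos : 0 < (minpoly F (α p)).natDegree := minpoly.natDegree_pos (hint p)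
    have hne1 : (minpoly F (α p)).natDegree ≠ 1 := by
      intro h1
      obtain ⟨c, hc⟩ := minpoly.natDegree_eq_one_iff.mp h1
      refine hB1 p hp hBp ⟨c, (algebraMap F (AlgebraicClosure F)).injective ?_⟩
      rw [map_natCast, ← hα p, ← hc, map_mul, sq]
    change Module.finrank F (IntermediateField.adjoin F {α p}) = 2
    rw [IntermediateField.adjoin.finrank (hint p)]
    omega
  have hopen : ∀ p, IsOpen (Hp p : Set (AlgebraicClosure F ≃ₐ[F] AlgebraicClosure F)) :=
    fun p => by
      haveI := hfd p
      exact (E p).fixingSubgroup_isOpen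
  have hidx : ∀ p : ℕ, p.Prime → B < p → (Hp p).index = 2 := fun p hp hBp => by
    change (E p).fixingSubgroup.index = 2
    rw [← IntermediateField.finrank_eq_fixingSubgroup_index, hdeg p hp hBp]
  have hinj : Set.InjOn Hp {p : ℕ | p.Prime ∧ B < p} := by
    rintro p ⟨hp, hBp⟩ q ⟨hq, hBq⟩ hH
    by_contra hne
    have hE : E p = E q := by
      have h := congrArg IntermediateField.fixedField hH
      change IntermediateField.fixedField (E p).fixingSubgroup =
        IntermediateField.fixedField (E q).fixingSubgroup at h
      rwa [InfiniteGalois.fixedField_fixingSubgroup,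
        InfiniteGalois.fixedField_fixingSubgroup] at h
    have hmem : α p ∈ IntermediateField.adjoin F {α q} := by
      have h : α p ∈ E p := IntermediateField.mem_adjoin_simple_self F (α p)
      rw [hE] at h
      exact h
    rcases isSquare_or_isSquare_mul_of_mem_adjoin_simple (F := F) two_ne_zero
        (hα' p) (hα' q) (hB1 q hq hBq) hmem with h | h
    · exact hB1 p hp hBp h
    · exact hB2 p q hp hq hBp hBq hne h
  have hmaps : Set.MapsTo Hp {p : ℕ | p.Prime ∧ B < p}
      {H | IsOpen (H : Set (AlgebraicClosure F ≃ₐ[F] AlgebraicClosure F)) ∧ H.index = 2} :=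
    fun p hp => ⟨hopen p, hidx p hp.1 hp.2⟩
  have hinf : {p : ℕ | p.Prime ∧ B < p}.Infinite := by
    have h : {p : ℕ | p.Prime ∧ B < p} = {p : ℕ | p.Prime} \ {p : ℕ | p ≤ B} := by
      ext p
      simp [not_le]
    rw [h]
    exact Nat.infinite_setOf_prime.sdiff (Set.finite_le_nat B)
  exact Set.infinite_of_injOn_mapsTo hinj hmaps hinf

/-- For a number field `F`, the Galois group `Gal(F̄/F)` (Mathlib's `F̄ ≃ₐ[F] F̄` with the Krull
topology) is NOT topologically finitely generated — the "not topologically finitely generated"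
clause of [AbsTopI] Thm 1.7 (iii) ("`G_k` is very elastic" for `k` an NF), in the case `k̃ = k̄`,
PROVED. [cite: MochizukiAbsTopI2012, Thm 1.7 (iii) p.14] -/
theorem not_isTopologicallyFinitelyGenerated_gal :
    ¬ IsTopologicallyFinitelyGenerated (AlgebraicClosure F ≃ₐ[F] AlgebraicClosure F) :=
  fun h => infinite_setOf_isOpen_index_two_gal F h.finite_setOf_isOpen_index_two

/-- **The absolute Galois group of a number field is not topologically finitely generated**
(`Field.absoluteGaloisGroup F`, transported along the identity from
`not_isTopologicallyFinitelyGenerated_gal`): the "not topologically finitely generated" clause of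
[AbsTopI] Thm 1.7 (iii) p. 14 ("if `k` is an NF, then `G_k` is very elastic and slim"; very
elastic ⟹ not topologically finitely generated by Def 1.1 (ii) p. 10), case `k̃ = k̄`, PROVED
(slimness and elasticity are NOT addressed here). [cite: MochizukiAbsTopI2012, Thm 1.7 (iii) p.14] -/
theorem not_isTopologicallyFinitelyGenerated_absoluteGaloisGroup :
    ¬ IsTopologicallyFinitelyGenerated (absoluteGaloisGroup F) := by
  intro h
  refine not_isTopologicallyFinitelyGenerated_gal F (h.of_continuousMulEquiv ?_)
  exact
    { absoluteGaloisGroup.toAlgEquiv F with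
      continuous_toFun := continuous_id
      continuous_invFun := continuous_id }

end Galois

/-! ### §6. [AbsTopI] Thm 2.6 (vi): `Π` is not topologically finitely generated -/

/-- **[AbsTopI] Thm 2.6 (vi)** "In particular, `Π` is not topologically finitely generated" —
DISCHARGED UNCONDITIONALLY: for every extension `1 → Δ → Π → G → 1` of profinite groups with
`G ≅ G_F`, `F` a number field, `Π` is not topologically finitely generated, since its quotient
`G_F` is not (`not_isTopologicallyFinitelyGenerated_absoluteGaloisGroup`).
[cite: MochizukiAbsTopI2012, Thm 2.6 (vi) p.22] -/
theorem FundamentalExtension.thm26_vi_not_tfg_holds : FundamentalExtension.thm26_vi_not_tfg := by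
  intro E B hPi
  letI := B.instField
  letI := B.instNumberField
  have hG : IsTopologicallyFinitelyGenerated (absoluteGaloisGroup B.F) :=
    (hPi.of_surjective E.aug E.aug_surjective).of_continuousMulEquiv B.galIso
  exact not_isTopologicallyFinitelyGenerated_absoluteGaloisGroup B.F hG

end Literature.AnabelianGeometry.AbsoluteAnabelian
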